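import Summits.HodgeConjecture.HodgeConjecture.Theorems.H413TowerConj
import HarnessLib

/-!
# FLOOR-0 P4/P3 — THE HODGE DECOMPOSITION OF THE TOWER: `H_K = H_K^{1,0} ⊕ conj H_K^{1,0}` levelwise and `H = H^{1,0} ⊕ conjT H^{1,0}` on the colimit

Cell hodgecm-mathlib (D-0151), FLOOR 0, crux item H413 = stmt-HodgeConjecture-24833.  Sequel of `Theorems/H413TowerConj.lean` (stub T2b of the P4 line
`Cruxes/H413/Lines/F0_P4AdmissibleOccursInH1.lean`); input of the P3 line `Cruxes/H413/Lines/F0_U3CohMultOne.lean`, stub `stub_S1_hodgeMatsushimaDecAt`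
(«`cls : cohForms 𝔞₀ → H¹_B` is an equivariant BIJECTION», F0P3-plan JOIN BRIEF §3) — the surjectivity bookkeeping: every class of the pin's tower is a
`(1,0)`-class plus the conjugate of a `(1,0)`-class, uniquely.  Author A-p19 (g15).  `--supports stmt-HodgeConjecture-24833 --as helper`.  Theorems only.

* §1 one variety: in weight one `H¹(X; ℂ) = F¹ ⊕ conj F¹` (opposedness ★ `HodgeStructure.isCompl_F_complexConj 1 1`, [DeligneHodgeII1971, 1.2.5]):
  every class is `p + conj q` with `p, q ∈ F¹`, uniquely (`exists_mem_F_add_conj`, `eq_of_add_conj_eq_add_conj`); the translates `t_γ^*` map such a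
  decomposition to a decomposition (they preserve `F¹` — ★ `Fact_pull_hodge` — and commute with `conj`);
* §2 one level: every `c ∈ towerLevel Γ` is `a + conjL b` with `a, b ∈ H10L Γ` (`exists_H10L_add_conjL`; the componentwise decompositions ARE families,
  by uniqueness), hence `IsCompl (H10L Γ) ((H10L Γ).map (conjL Γ))` (`isCompl_H10L_map_conjL`); `translate g` preserves `H10L` (`translate_mem_H10L`);
* §3 the tower: every `x ∈ Tower … V` is `a + conjT b` with `a, b ∈ H10T` (`exists_H10T_add_conjT`), **`isCompl_H10T_map_conjT :
  IsCompl (H10T V) ((H10T V).map (conjT V))`** — the Hodge decomposition `H¹_B = H^{1,0} ⊕ H^{0,1}` of the pin's tower module — and both summands are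
  stable under the Hecke action `act g` (`act_mem_H10T`, `act_mem_map_conjT_H10T`).

HC_CM is proved only modulo the 7 printed citations until rung 0 closes; this file proves nothing about them.
[cite: DeligneHodgeII1971, 1.2.5] [cite: VoisinHodgeI2002, §7.1] [cite: BorelWallach2000, VII 2.10]

## References
* [DeligneHodgeII1971] P. Deligne, *Théorie de Hodge II*, Publ. Math. IHÉS 40 (1971), 1.2.5 (opposed filtrations: `V_ℂ = ⊕ F^p ∩ conj F^q`).
* [VoisinHodgeI2002] C. Voisin, *Hodge Theory and Complex Algebraic Geometry I*, §7.1 (Hodge decomposition, functoriality under pull-back).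
* [BorelWallach2000] A. Borel, N. Wallach, 2nd ed., VII 2.10 (Hodge types of the cohomology of compact locally symmetric varieties and the Hecke action).
* Tree: `Theorems/H413TowerConj` (`conjL`, `conjT`, `H10L`, `H10T`, `conj_trPull`, `trPull_mem_F`, `eq_zero_of_mem_H10L_of_conjL_mem`,
  `eq_zero_of_mem_H10T_of_conjT_eq`, `translate_conjL`, `conjT_act`), HodgeCM `Model/TowerLevel_1` / `TowerCarrier`.
-/

set_option autoImplicit false
set_option linter.dupNamespace false

noncomputable section

open Function Set
open Literature.AlgebraicGeometry.Motives
open Literature.AlgebraicGeometry.ShimuraVarieties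
open Literature.AlgebraicGeometry.HodgeTheory
open Literature.NumberTheory.Automorphic
open Literature.NumberTheory.Automorphic.PicardCM
open Literature.NumberTheory.Transcendental (Arapura2012_Cor_15_4_6)
open HodgeCM HodgeCM.Model HodgeCM.Model.LevelTranslate HodgeCM.Model.TowerLevel HodgeCM.Model.TowerCarrier

namespace Summit.HodgeConjecture.HodgeConjecture.Cruxes.H413.TowerConj

variable (hHD : exists_isReal_hodgeModel) (hI : hodgePQ_independent_of_hodgeModel)
  (hU : BallQuotientUniformisedDatum) (h₃ : CMAbelianVarietyRealised) (hA : Arapura2012_Cor_15_4_6)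
variable {L : CMField} {ι₁ : L →+* ℂ} {V : HermSpace3 L ι₁}

/-! ## §1 One variety: `H¹(X; ℂ) = F¹ ⊕ conj F¹` in weight one -/

/-- In weight one every class is `p + conj q` with `p, q ∈ F¹` (`F¹` and `conj F¹` are complementary). [cite: DeligneHodgeII1971, 1.2.5] -/
theorem exists_mem_F_add_conj {W : Type} [AddCommGroup W] [Module ℚ W] (H : HodgeStructure W ((1 : ℕ) : ℤ)) (x : TensorProduct ℚ ℂ W) :
    ∃ p q : TensorProduct ℚ ℂ W, p ∈ H.F 1 ∧ q ∈ H.F 1 ∧ x = p + HodgeStructure.conj q := by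
  have hc : IsCompl (H.F 1) (HodgeStructure.complexConj (H.F 1)) := H.isCompl_F_complexConj 1 1 (by norm_num)
  obtain ⟨p, r, hp, hr, hpr⟩ := (Submodule.codisjoint_iff_exists_add_eq.mp hc.codisjoint) x
  exact ⟨p, HodgeStructure.conj r, hp, HodgeStructure.mem_complexConj.mp hr, by rw [HodgeStructure.conj_conj, hpr]⟩

/-- Uniqueness of the weight-one decomposition: `p + conj q = p' + conj q'` with all four classes in `F¹` forces `p = p'` and `q = q'`.
[cite: DeligneHodgeII1971, 1.2.5] -/
theorem eq_of_add_conj_eq_add_conj {W : Type} [AddCommGroup W] [Module ℚ W] (H : HodgeStructure W ((1 : ℕ) : ℤ))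
    {p q p' q' : TensorProduct ℚ ℂ W} (hp : p ∈ H.F 1) (hq : q ∈ H.F 1) (hp' : p' ∈ H.F 1) (hq' : q' ∈ H.F 1)
    (h : p + HodgeStructure.conj q = p' + HodgeStructure.conj q') : p = p' ∧ q = q' := by
  -- `p - p' = conj (q' - q)` lies in `F¹ ∩ conj F¹ = 0`
  have hd : p - p' = HodgeStructure.conj (q' - q) := by
    rw [map_sub, sub_eq_sub_iff_add_eq_add, add_comm (HodgeStructure.conj q') p']
    exact h
  have h1 : p - p' = 0 :=
    eq_zero_of_mem_F_one_of_conj_mem H (Submodule.sub_mem _ hp hp')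
      (by rw [hd, HodgeStructure.conj_conj]; exact Submodule.sub_mem _ hq' hq)
  have h2 : q' - q = 0 := by
    have : HodgeStructure.conj (q' - q) = 0 := by rw [← hd, h1]
    simpa only [HodgeStructure.conj_conj, map_zero] using congrArg HodgeStructure.conj this
  exact ⟨sub_eq_zero.mp h1, (sub_eq_zero.mp h2).symm⟩

/-- `t_γ^*` maps the weight-one decomposition of a class to that of its image (it preserves `F¹` and commutes with `conj`).
[cite: VoisinHodgeI2002, §7.1] -/
theorem trPull_add_conj (γ : ↥(Urat V)) (Δ₁ Δ₂ : Level V) (ht : TransCond (γ : GL (Fin 3) L) Δ₁ Δ₂) (p q : Coh hHD hI hU h₃ Δ₂ 1) :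
    trPull hHD hI hU h₃ hA γ Δ₁ Δ₂ ht 1 (p + HodgeStructure.conj q) =
      trPull hHD hI hU h₃ hA γ Δ₁ Δ₂ ht 1 p + HodgeStructure.conj (trPull hHD hI hU h₃ hA γ Δ₁ Δ₂ ht 1 q) := by
  rw [map_add, conj_trPull]

/-! ## §2 One level: `towerLevel Γ = H10L Γ ⊕ conjL (H10L Γ)` -/

section Level

variable {Γ : Level V} {hΓ : Γ.BelowConjThree}

/-- **Every level family is a `(1,0)`-family plus the conjugate of a `(1,0)`-family**: the componentwise weight-one decompositions of
`c ∈ towerLevel Γ` are themselves families (compatible with the translates `t_γ^*`, by uniqueness). [cite: DeligneHodgeII1971, 1.2.5]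
[cite: BorelWallach2000, VII 2.10] -/
theorem exists_H10L_add_conjL (c : towerLevel hHD hI hU h₃ hA Γ hΓ) :
    ∃ a b : towerLevel hHD hI hU h₃ hA Γ hΓ, a ∈ H10L hHD hI hU h₃ hA Γ hΓ ∧ b ∈ H10L hHD hI hU h₃ hA Γ hΓ ∧
      c = a + conjL hHD hI hU h₃ hA Γ hΓ b := by
  -- componentwise decomposition
  choose p q hp hq hpq using fun h : V.adelicFin ↦
    exists_mem_F_add_conj ((universeOf hHD hI hU h₃).hodge ((universeOf hHD hI hU h₃).pms L ι₁ V (Γ.conj h hΓ)) 1)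
      ((c : Π h, W hHD hI hU h₃ Γ hΓ h) h)
  -- the components `p`, `q` are families
  have key : ∀ (γ : ↥(Urat V)) (h h' : V.adelicFin) (r : Rel Γ γ h h'),
      p h = trPull hHD hI hU h₃ hA γ (Γ.conj h hΓ) (Γ.conj h' hΓ) (transCond_of_rel hΓ r) 1 (p h') ∧
        q h = trPull hHD hI hU h₃ hA γ (Γ.conj h hΓ) (Γ.conj h' hΓ) (transCond_of_rel hΓ r) 1 (q h') := by
    intro γ h h' r
    have hc := apply_eq_trPull hHD hI hU h₃ hA c r (transCond_of_rel hΓ r)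
    rw [hpq h, hpq h', trPull_add_conj] at hc
    exact eq_of_add_conj_eq_add_conj _ (hp h) (hq h) (trPull_mem_F hHD hI hU h₃ hA γ _ _ _ 1 (hp h'))
      (trPull_mem_F hHD hI hU h₃ hA γ _ _ _ 1 (hq h')) hc
  refine ⟨⟨p, (mem_towerLevel_iff hHD hI hU h₃ hA).mpr fun γ h h' r ↦ (key γ h h' r).1⟩,
    ⟨q, (mem_towerLevel_iff hHD hI hU h₃ hA).mpr fun γ h h' r ↦ (key γ h h' r).2⟩,
    (mem_H10L_iff hHD hI hU h₃ hA _).mpr hp, (mem_H10L_iff hHD hI hU h₃ hA _).mpr hq, ?_⟩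
  apply Subtype.ext; funext h
  simp only [Submodule.coe_add, Pi.add_apply, conjL_apply]
  exact hpq h

/-- `H10L Γ + conjL (H10L Γ) = H_K`. [cite: DeligneHodgeII1971, 1.2.5] -/
theorem H10L_sup_map_conjL_eq_top :
    H10L hHD hI hU h₃ hA Γ hΓ ⊔ (H10L hHD hI hU h₃ hA Γ hΓ).map (conjL hHD hI hU h₃ hA Γ hΓ) = ⊤ := by
  rw [eq_top_iff]
  intro c _
  obtain ⟨a, b, ha, hb, rfl⟩ := exists_H10L_add_conjL hHD hI hU h₃ hA c
  exact Submodule.add_mem_sup ha (Submodule.mem_map_of_mem hb)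

/-- **The Hodge decomposition of the level carrier**: `H_K = H10L ⊕ conjL H10L` (complementary subspaces). [cite: DeligneHodgeII1971, 1.2.5]
[cite: BorelWallach2000, VII 2.10] -/
theorem isCompl_H10L_map_conjL :
    IsCompl (H10L hHD hI hU h₃ hA Γ hΓ) ((H10L hHD hI hU h₃ hA Γ hΓ).map (conjL hHD hI hU h₃ hA Γ hΓ)) := by
  refine ⟨Submodule.disjoint_def.mpr fun x hx hx' ↦ ?_, codisjoint_iff.mpr (H10L_sup_map_conjL_eq_top hHD hI hU h₃ hA)⟩
  obtain ⟨y, hy, rfl⟩ := Submodule.mem_map.mp hx'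
  exact eq_zero_of_mem_H10L_of_conjL_mem hHD hI hU h₃ hA hx (by rw [conjL_conjL]; exact hy)

/-- `translate g` preserves the `(1,0)`-families (it is componentwise `t_1^*`). [cite: VoisinHodgeI2002, §7.1] -/
theorem translate_mem_H10L (g : V.adelicFin) {c : towerLevel hHD hI hU h₃ hA Γ hΓ} (hc : c ∈ H10L hHD hI hU h₃ hA Γ hΓ) :
    translate hHD hI hU h₃ hA hΓ g c ∈ H10L hHD hI hU h₃ hA (Γ.conj g hΓ) (hΓ.conj g) := by
  rw [mem_H10L_iff] at hc ⊢
  intro h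
  rw [translate_apply]
  exact trPull_mem_F hHD hI hU h₃ hA 1 _ _ _ 1 (hc (h * g))

end Level

/-! ## §3 The tower: `H = H10T ⊕ conjT H10T`, and both summands are Hecke-stable -/

section Tower

variable (V)

/-- **Every class of the tower is a `(1,0)`-class plus the conjugate of a `(1,0)`-class.** [cite: DeligneHodgeII1971, 1.2.5]
[cite: BorelWallach2000, VII 2.10] -/
theorem exists_H10T_add_conjT (x : Tower hHD hI hU h₃ hA V) :
    ∃ a b : Tower hHD hI hU h₃ hA V, a ∈ H10T hHD hI hU h₃ hA V ∧ b ∈ H10T hHD hI hU h₃ hA V ∧ x = a + conjT hHD hI hU h₃ hA V b := by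
  obtain ⟨Γ, hΓ, c, rfl⟩ := exists_ofLevel hHD hI hU h₃ hA x
  obtain ⟨a, b, ha, hb, rfl⟩ := exists_H10L_add_conjL hHD hI hU h₃ hA c
  refine ⟨ofLevel hHD hI hU h₃ hA Γ hΓ a, ofLevel hHD hI hU h₃ hA Γ hΓ b,
    (mem_H10T_iff hHD hI hU h₃ hA V _).mpr ⟨TLvl.mk Γ hΓ, a, ha, rfl⟩,
    (mem_H10T_iff hHD hI hU h₃ hA V _).mpr ⟨TLvl.mk Γ hΓ, b, hb, rfl⟩, ?_⟩
  rw [map_add, conjT_ofLevel]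

/-- `H10T + conjT H10T = H`. [cite: DeligneHodgeII1971, 1.2.5] -/
theorem H10T_sup_map_conjT_eq_top :
    H10T hHD hI hU h₃ hA V ⊔ (H10T hHD hI hU h₃ hA V).map (conjT hHD hI hU h₃ hA V) = ⊤ := by
  rw [eq_top_iff]
  intro x _
  obtain ⟨a, b, ha, hb, rfl⟩ := exists_H10T_add_conjT hHD hI hU h₃ hA V x
  exact Submodule.add_mem_sup ha (Submodule.mem_map_of_mem hb)

/-- **The Hodge decomposition of the tower `H¹_B = H^{1,0} ⊕ H^{0,1}`**: the `(1,0)`-part `H10T` and its conjugate `conjT H10T` are complementary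
subspaces of `Tower … V`. [cite: DeligneHodgeII1971, 1.2.5] [cite: VoisinHodgeI2002, §7.1] [cite: BorelWallach2000, VII 2.10] -/
theorem isCompl_H10T_map_conjT :
    IsCompl (H10T hHD hI hU h₃ hA V) ((H10T hHD hI hU h₃ hA V).map (conjT hHD hI hU h₃ hA V)) := by
  refine ⟨Submodule.disjoint_def.mpr fun x hx hx' ↦ ?_, codisjoint_iff.mpr (H10T_sup_map_conjT_eq_top hHD hI hU h₃ hA V)⟩
  obtain ⟨y, hy, rfl⟩ := Submodule.mem_map.mp hx'
  exact eq_zero_of_mem_H10T_of_conjT_eq hHD hI hU h₃ hA hx hy rfl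

variable {V}

/-- The `(1,0)`-part of the tower is stable under the Hecke action. [cite: BorelWallach2000, VII 2.10] -/
theorem act_mem_H10T (g : V.adelicFin) {x : Tower hHD hI hU h₃ hA V} (hx : x ∈ H10T hHD hI hU h₃ hA V) :
    act hHD hI hU h₃ hA g x ∈ H10T hHD hI hU h₃ hA V := by
  obtain ⟨j, c, hc, rfl⟩ := (mem_H10T_iff hHD hI hU h₃ hA V x).mp hx
  rw [act_ofLevel]
  exact (mem_H10T_iff hHD hI hU h₃ hA V _).mpr ⟨TLvl.mk (j.1.conj g j.2) (j.2.conj g), _, translate_mem_H10L hHD hI hU h₃ hA g hc, rfl⟩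

/-- The `(0,1)`-part `conjT H10T` of the tower is stable under the Hecke action. [cite: BorelWallach2000, VII 2.10] -/
theorem act_mem_map_conjT_H10T (g : V.adelicFin) {x : Tower hHD hI hU h₃ hA V}
    (hx : x ∈ (H10T hHD hI hU h₃ hA V).map (conjT hHD hI hU h₃ hA V)) :
    act hHD hI hU h₃ hA g x ∈ (H10T hHD hI hU h₃ hA V).map (conjT hHD hI hU h₃ hA V) := by
  obtain ⟨y, hy, rfl⟩ := Submodule.mem_map.mp hx
  rw [← conjT_act]
  exact Submodule.mem_map_of_mem (act_mem_H10T hHD hI hU h₃ hA g hy)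

/-- The `(1,0)`-part of the tower is stable under the representation `towerRep`. -/
theorem towerRep_mem_H10T (g : V.adelicFin) {x : Tower hHD hI hU h₃ hA V} (hx : x ∈ H10T hHD hI hU h₃ hA V) :
    towerRep hHD hI hU h₃ hA V g x ∈ H10T hHD hI hU h₃ hA V :=
  act_mem_H10T hHD hI hU h₃ hA g hx

end Tower

end Summit.HodgeConjecture.HodgeConjecture.Cruxes.H413.TowerConj

end
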